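import Summits.NavierStokesRegularity.FluidComputer.PalasekTowerGermHostFarFieldSign

/-!
# The germ host, XVIII: the SHARP FAR-FIELD BOUND for the pressure gradient of a far structure

Cell `ns-blowup`, seat `ns-blowup-ecbridge-3` (g4); GROUP C «BRIDGE SUPPORT» of the route
`PalasekTowerBreakdown` (crux `EpisodeBaseG`, item stmt-NavierStokesRegularity-19179, R2 of record;
registered line `Cruxes/EpisodeBase/Lines/slot.lean`, whose one stub quantifies over the STRICT slot
`Germ.LevelZeroData`). LABEL: E–C typing (KERNEL calculus: inequalities, no definition). WHAT THIS IS
NOT: not Navier–Stokes evidence — potential theory of a PRESCRIBED compactly supported profile at one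
instant; nothing about any flow after `τ₀`, `FirstEpisodeD`, `RungG 1` or blow-up.

## What and why

The slots of record certify host preparation for ONE profile `U`; a design seat adding to a certified
carrier `U₁` a second structure `U₂` (ring, dipole, jet — the would-be amplifier of the episode) moves
the anchor value at an argmax point `x₀` of the carrier by exactly `−⟪U₁(x₀), ∇π[U₂](x₀)⟫`
(GermHost VI, `accel_add_of_notMem`), and GermHost IX (`inner_gradient_pot_eq_neg_integral_fderiv3`,
p450530) writes `⟪∇π[U₂](x₀), e⟫ = −∫ D³Γ(x₀ − x)(U₂ x, U₂ x, e) dx`. This file makes the size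
QUANTITATIVE, with the sharp constant:

* §1 **`abs_fderiv3_newtonKernel_vva_le`**: `|D³Γ(z)(v, v, a)| ≤ 3‖v‖²‖a‖ / (2π‖z‖⁴)` for `z ≠ 0`
  (equality at `v ∥ a ∥ z`; proof: split `v, a` along and across `z`, Cauchy–Schwarz on the transversal
  parts, one weighted Cauchy–Schwarz in the plane — the polynomial heart is `sq_fderiv3_numerator_le`);
* §2 **THE FAR-FIELD BOUND** `abs_inner_gradient_pot_le_of_far`: for a divergence-free `U ∈ C_c^∞`
  whose support stays at distance `≥ d > 0` from `x₀`,
  `|⟪∇π[U](x₀), e⟫| ≤ (3/(2πd⁴)) ‖e‖ ∫‖U‖²`, and `norm_gradient_pot_le_of_far`: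
  `‖∇π[U](x₀)‖ ≤ (3/(2πd⁴)) ∫‖U‖²` — the pressure push of a far structure at a point is at most its
  ENERGY over `d⁴` (times `3/(2π)`), whatever its shape, sign or direction.

The companion rule for the three slots built on this bound is the sequel `PalasekTowerGermHostCompanion`.

References: D. Gilbarg, N. S. Trudinger, *Elliptic PDE of Second Order* (2001), (2.13), Lemma 4.1
[cite: GilbargTrudinger2001, (2.13)]; A. J. Majda, A. L. Bertozzi, *Vorticity and Incompressible Flow*
(CUP 2002), §1.8 Prop. 1.16 [cite: MajdaBertozziCUP2002, §1.8 Prop. 1.16].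
-/

noncomputable section

namespace Summit.NavierStokesRegularity.FluidComputer.PalasekTowerClayBridge.Germ

open Set Function Filter Topology InnerProductSpace Metric MeasureTheory Real
open scoped Topology ContDiff RealInnerProductSpace

open Literature.Analysis.FluidPDE

-- nested operator types `ℝ³ →L[ℝ] ℝ³ →L[ℝ] ℝ` (second derivatives)
set_option maxSynthPendingDepth 3

/-! ## §1 The sharp size of `D³Γ(z)(v, v, a)` -/

/-- The polynomial heart of the sharp bound: with `Z = ‖z‖²`, `p = ⟨z,v⟩`, `q = ⟨z,a⟩`, `W, B` the
squared norms of the parts of `v, a` orthogonal to `z` and `t` their inner product (`t² ≤ WB`), the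
numerator `6p²q − 3ZWq − 6Zpt` of `4π‖z‖⁷ · D³Γ(z)(v,v,a)` has square `≤ 36 (ZW + p²)² (ZB + q²)`
(`= 36 Z³‖v‖⁴‖a‖²`). [folklore] -/
theorem sq_fderiv3_numerator_le {Z W B p q t : ℝ} (hZ : 0 < Z) (hW : 0 ≤ W) (hB : 0 ≤ B)
    (ht : t ^ 2 ≤ W * B) :
    (6 * p ^ 2 * q - 3 * Z * W * q - 6 * Z * p * t) ^ 2 ≤
      36 * (Z * W + p ^ 2) ^ 2 * (Z * B + q ^ 2) := by
  rcases hW.eq_or_lt with hW0 | hWpos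
  · -- no transversal part: `t = 0`
    have ht0 : t ^ 2 = 0 := le_antisymm (by rw [← hW0, zero_mul] at ht; exact ht) (sq_nonneg t)
    have ht' : t = 0 := pow_eq_zero_iff two_ne_zero |>.1 ht0
    rw [← hW0, ht']
    have key : 0 ≤ p ^ 4 * (Z * B) := by positivity
    nlinarith [key, sq_nonneg p, sq_nonneg q]
  · -- weighted Cauchy–Schwarz in the plane
    have h1 : (3 * (2 * p ^ 2 - Z * W) * q + -(6 * Z * p) * t) ^ 2 * (W * Z) ≤
        ((3 * (2 * p ^ 2 - Z * W)) ^ 2 * Z + (6 * Z * p) ^ 2 * W) * (W * q ^ 2 + Z * t ^ 2) := by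
      nlinarith [sq_nonneg (3 * (2 * p ^ 2 - Z * W) * Z * t - -(6 * Z * p) * W * q)]
    have h2 : W * q ^ 2 + Z * t ^ 2 ≤ W * (Z * B + q ^ 2) := by
      nlinarith [mul_le_mul_of_nonneg_left ht hZ.le]
    have h3 : (3 * (2 * p ^ 2 - Z * W)) ^ 2 * Z + (6 * Z * p) ^ 2 * W ≤
        36 * Z * (Z * W + p ^ 2) ^ 2 := by
      nlinarith [mul_nonneg (pow_nonneg hZ.le 3) (sq_nonneg W),
        mul_nonneg (mul_nonneg (sq_nonneg Z) hW) (sq_nonneg p)]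
    have hA : 0 ≤ (3 * (2 * p ^ 2 - Z * W)) ^ 2 * Z + (6 * Z * p) ^ 2 * W :=
      add_nonneg (mul_nonneg (sq_nonneg _) hZ.le) (mul_nonneg (sq_nonneg _) hW)
    have hC : 0 ≤ W * (Z * B + q ^ 2) :=
      mul_nonneg hW (add_nonneg (mul_nonneg hZ.le hB) (sq_nonneg q))
    have h4 : (3 * (2 * p ^ 2 - Z * W) * q + -(6 * Z * p) * t) ^ 2 * (W * Z) ≤
        36 * (Z * W + p ^ 2) ^ 2 * (Z * B + q ^ 2) * (W * Z) :=
      calc (3 * (2 * p ^ 2 - Z * W) * q + -(6 * Z * p) * t) ^ 2 * (W * Z)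
          ≤ ((3 * (2 * p ^ 2 - Z * W)) ^ 2 * Z + (6 * Z * p) ^ 2 * W) * (W * q ^ 2 + Z * t ^ 2) := h1
        _ ≤ ((3 * (2 * p ^ 2 - Z * W)) ^ 2 * Z + (6 * Z * p) ^ 2 * W) * (W * (Z * B + q ^ 2)) :=
            mul_le_mul_of_nonneg_left h2 hA
        _ ≤ 36 * Z * (Z * W + p ^ 2) ^ 2 * (W * (Z * B + q ^ 2)) :=
            mul_le_mul_of_nonneg_right h3 hC
        _ = 36 * (Z * W + p ^ 2) ^ 2 * (Z * B + q ^ 2) * (W * Z) := by ring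
    have hN : 6 * p ^ 2 * q - 3 * Z * W * q - 6 * Z * p * t =
        3 * (2 * p ^ 2 - Z * W) * q + -(6 * Z * p) * t := by ring
    rw [hN]
    exact le_of_mul_le_mul_right h4 (mul_pos hWpos hZ)

/-- **THE SHARP SIZE OF THE THIRD DERIVATIVE OF `Γ` ON A REPEATED DIRECTION**:
`|D³Γ(z)(v, v, a)| ≤ 3‖v‖²‖a‖ / (2π‖z‖⁴)` for `z ≠ 0` (equality at `v ∥ a ∥ z`).
[cite: GilbargTrudinger2001, (2.13)] -/
theorem abs_fderiv3_newtonKernel_vva_le {z : EuclideanSpace ℝ (Fin 3)} (hz : z ≠ 0)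
    (v a : EuclideanSpace ℝ (Fin 3)) :
    |fderiv ℝ (fun w => fderiv ℝ (fun w' => fderiv ℝ newtonKernel w' v) w v) z a| ≤
      3 * ‖v‖ ^ 2 * ‖a‖ / (2 * π * ‖z‖ ^ 4) := by
  rw [fderiv3_newtonKernel_apply hz]
  have hzn : 0 < ‖z‖ := norm_pos_iff.2 hz
  have hZ : 0 < ‖z‖ ^ 2 := by positivity
  have hZne : ‖z‖ ^ 2 ≠ 0 := hZ.ne'
  -- the parts of `v` and `a` across `z`
  set v' : EuclideanSpace ℝ (Fin 3) := v - (⟪z, v⟫ / ‖z‖ ^ 2) • z with hv'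
  set a' : EuclideanSpace ℝ (Fin 3) := a - (⟪z, a⟫ / ‖z‖ ^ 2) • z with ha'
  have hW : ‖v'‖ ^ 2 = ‖v‖ ^ 2 - ⟪z, v⟫ ^ 2 / ‖z‖ ^ 2 := by
    rw [hv', norm_sub_sq_real, real_inner_smul_right, real_inner_comm v z, norm_smul,
      mul_pow, Real.norm_eq_abs, sq_abs]
    field_simp
    ring
  have hB : ‖a'‖ ^ 2 = ‖a‖ ^ 2 - ⟪z, a⟫ ^ 2 / ‖z‖ ^ 2 := by
    rw [ha', norm_sub_sq_real, real_inner_smul_right, real_inner_comm a z, norm_smul,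
      mul_pow, Real.norm_eq_abs, sq_abs]
    field_simp
    ring
  have ht : ⟪v', a'⟫ = ⟪v, a⟫ - ⟪z, v⟫ * ⟪z, a⟫ / ‖z‖ ^ 2 := by
    rw [hv', ha', inner_sub_left, inner_sub_right, inner_sub_right, real_inner_smul_left,
      real_inner_smul_right, real_inner_smul_left, real_inner_smul_right, real_inner_comm v z,
      real_inner_self_eq_norm_sq]
    field_simp
    ring
  have hCS : ⟪v', a'⟫ ^ 2 ≤ ‖v'‖ ^ 2 * ‖a'‖ ^ 2 := by
    have h := abs_real_inner_le_norm v' a'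
    have h0 : 0 ≤ ‖v'‖ * ‖a'‖ := by positivity
    calc ⟪v', a'⟫ ^ 2 = |⟪v', a'⟫| ^ 2 := (sq_abs _).symm
      _ ≤ (‖v'‖ * ‖a'‖) ^ 2 := pow_le_pow_left₀ (abs_nonneg _) h 2
      _ = ‖v'‖ ^ 2 * ‖a'‖ ^ 2 := by ring
  -- the numerator in terms of the split
  have hnum : 15 * ⟪z, v⟫ * ⟪z, v⟫ * ⟪z, a⟫ -
      3 * ‖z‖ ^ 2 * (⟪v, v⟫ * ⟪z, a⟫ + ⟪v, a⟫ * ⟪z, v⟫ + ⟪v, a⟫ * ⟪z, v⟫) =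
      6 * ⟪z, v⟫ ^ 2 * ⟪z, a⟫ - 3 * ‖z‖ ^ 2 * ‖v'‖ ^ 2 * ⟪z, a⟫ -
        6 * ‖z‖ ^ 2 * ⟪z, v⟫ * ⟪v', a'⟫ := by
    rw [hW, ht, real_inner_self_eq_norm_sq]
    field_simp
    ring
  have hsq := sq_fderiv3_numerator_le (p := ⟪z, v⟫) (q := ⟪z, a⟫) hZ (sq_nonneg ‖v'‖)
    (sq_nonneg ‖a'‖) hCS
  -- `(ZW + p²) = Z‖v‖²`, `(ZB + q²) = Z‖a‖²`
  have hZV : ‖z‖ ^ 2 * ‖v'‖ ^ 2 + ⟪z, v⟫ ^ 2 = ‖z‖ ^ 2 * ‖v‖ ^ 2 := by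
    rw [hW]; field_simp; ring
  have hZA : ‖z‖ ^ 2 * ‖a'‖ ^ 2 + ⟪z, a⟫ ^ 2 = ‖z‖ ^ 2 * ‖a‖ ^ 2 := by
    rw [hB]; field_simp; ring
  rw [hZV, hZA] at hsq
  have habs : |15 * ⟪z, v⟫ * ⟪z, v⟫ * ⟪z, a⟫ -
      3 * ‖z‖ ^ 2 * (⟪v, v⟫ * ⟪z, a⟫ + ⟪v, a⟫ * ⟪z, v⟫ + ⟪v, a⟫ * ⟪z, v⟫)| ≤
      6 * ‖z‖ ^ 3 * ‖v‖ ^ 2 * ‖a‖ := by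
    rw [hnum]
    refine abs_le_of_sq_le_sq ?_ (by positivity)
    calc (6 * ⟪z, v⟫ ^ 2 * ⟪z, a⟫ - 3 * ‖z‖ ^ 2 * ‖v'‖ ^ 2 * ⟪z, a⟫ -
          6 * ‖z‖ ^ 2 * ⟪z, v⟫ * ⟪v', a'⟫) ^ 2
        ≤ 36 * (‖z‖ ^ 2 * ‖v‖ ^ 2) ^ 2 * (‖z‖ ^ 2 * ‖a‖ ^ 2) := hsq
      _ = (6 * ‖z‖ ^ 3 * ‖v‖ ^ 2 * ‖a‖) ^ 2 := by ring
  have hden : 0 < 4 * π * ‖z‖ ^ 7 := by positivity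
  calc |(15 * ⟪z, v⟫ * ⟪z, v⟫ * ⟪z, a⟫ -
        3 * ‖z‖ ^ 2 * (⟪v, v⟫ * ⟪z, a⟫ + ⟪v, a⟫ * ⟪z, v⟫ + ⟪v, a⟫ * ⟪z, v⟫)) /
        (4 * π * ‖z‖ ^ 7)|
      = |15 * ⟪z, v⟫ * ⟪z, v⟫ * ⟪z, a⟫ -
          3 * ‖z‖ ^ 2 * (⟪v, v⟫ * ⟪z, a⟫ + ⟪v, a⟫ * ⟪z, v⟫ + ⟪v, a⟫ * ⟪z, v⟫)| /
          (4 * π * ‖z‖ ^ 7) := by rw [abs_div, abs_of_pos hden]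
    _ ≤ 6 * ‖z‖ ^ 3 * ‖v‖ ^ 2 * ‖a‖ / (4 * π * ‖z‖ ^ 7) := by gcongr
    _ = 3 * ‖v‖ ^ 2 * ‖a‖ / (2 * π * ‖z‖ ^ 4) := by
        field_simp
        ring

/-! ## §2 The far-field bound for the pressure gradient -/

/-- **THE FAR-FIELD BOUND.** For a divergence-free `U ∈ C_c^∞` whose support stays at distance `≥ d > 0`
from `x₀`: `|⟪∇π[U](x₀), e⟫| ≤ (3 / (2π d⁴)) ‖e‖ ∫ ‖U‖²` (`π[U] = Δ⁻¹ div(νΔU − (U·∇)U)`, any `ν` —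
the viscous part does not reach `x₀`). [cite: GilbargTrudinger2001, Lemma 4.1] -/
theorem abs_inner_gradient_pot_le_of_far {ν : ℝ}
    {U : EuclideanSpace ℝ (Fin 3) → EuclideanSpace ℝ (Fin 3)} (hU : ContDiff ℝ ∞ U)
    (hUc : HasCompactSupport U) (hdiv : VectorCalculus.IsDivFree U) {x₀ : EuclideanSpace ℝ (Fin 3)}
    {d : ℝ} (hd : 0 < d) (hfar : ∀ x ∈ tsupport U, d ≤ ‖x₀ - x‖) (e : EuclideanSpace ℝ (Fin 3)) :
    |⟪gradient (pot ν U) x₀, e⟫| ≤ 3 / (2 * π * d ^ 4) * ‖e‖ * ∫ x, ‖U x‖ ^ 2 := by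
  have hfar' : ∀ x ∈ tsupport U, d / 2 < ‖x₀ - x‖ := fun x hx => by linarith [hfar x hx]
  rw [inner_gradient_pot_eq_neg_integral_fderiv3 hU hUc hdiv (half_pos hd) hfar' e, abs_neg]
  -- the dominating integrand
  have hG : Integrable fun x => 3 / (2 * π * d ^ 4) * ‖e‖ * ‖U x‖ ^ 2 := by
    have hc : Continuous fun x => ‖U x‖ ^ 2 := (hU.continuous.norm).pow 2
    have hcs : HasCompactSupport fun x => ‖U x‖ ^ 2 :=
      hUc.norm.comp_left (g := fun r : ℝ => r ^ 2) (by simp)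
    exact (hc.integrable_of_hasCompactSupport hcs).const_mul _
  have hFG : ∀ x, ‖fderiv ℝ (fun w => fderiv ℝ (fun w' => fderiv ℝ newtonKernel w' (U x)) w (U x))
      (x₀ - x) e‖ ≤ 3 / (2 * π * d ^ 4) * ‖e‖ * ‖U x‖ ^ 2 := by
    intro x
    by_cases hx : x ∈ tsupport U
    · have hdx : d ≤ ‖x₀ - x‖ := hfar x hx
      have hzx : x₀ - x ≠ 0 := by
        intro h
        rw [h, norm_zero] at hdx
        linarith
      rw [Real.norm_eq_abs]
      refine (abs_fderiv3_newtonKernel_vva_le hzx (U x) e).trans ?_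
      have hz4 : d ^ 4 ≤ ‖x₀ - x‖ ^ 4 := pow_le_pow_left₀ hd.le hdx 4
      calc 3 * ‖U x‖ ^ 2 * ‖e‖ / (2 * π * ‖x₀ - x‖ ^ 4)
          ≤ 3 * ‖U x‖ ^ 2 * ‖e‖ / (2 * π * d ^ 4) := by gcongr
        _ = 3 / (2 * π * d ^ 4) * ‖e‖ * ‖U x‖ ^ 2 := by ring
    · have hU0 : U x = 0 := image_eq_zero_of_notMem_tsupport hx
      simp only [hU0, map_zero, fderiv_fun_const, Pi.zero_apply, zero_apply, norm_zero]
      positivity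
  calc |∫ x, fderiv ℝ (fun w => fderiv ℝ (fun w' => fderiv ℝ newtonKernel w' (U x)) w (U x))
        (x₀ - x) e|
      = ‖∫ x, fderiv ℝ (fun w => fderiv ℝ (fun w' => fderiv ℝ newtonKernel w' (U x)) w (U x))
          (x₀ - x) e‖ := (Real.norm_eq_abs _).symm
    _ ≤ ∫ x, 3 / (2 * π * d ^ 4) * ‖e‖ * ‖U x‖ ^ 2 :=
        norm_integral_le_of_norm_le hG (Eventually.of_forall hFG)
    _ = 3 / (2 * π * d ^ 4) * ‖e‖ * ∫ x, ‖U x‖ ^ 2 := integral_const_mul _ _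

/-- **Norm form**: `‖∇π[U](x₀)‖ ≤ (3 / (2π d⁴)) ∫ ‖U‖²` under the same hypotheses.
[cite: GilbargTrudinger2001, Lemma 4.1] -/
theorem norm_gradient_pot_le_of_far {ν : ℝ}
    {U : EuclideanSpace ℝ (Fin 3) → EuclideanSpace ℝ (Fin 3)} (hU : ContDiff ℝ ∞ U)
    (hUc : HasCompactSupport U) (hdiv : VectorCalculus.IsDivFree U) {x₀ : EuclideanSpace ℝ (Fin 3)}
    {d : ℝ} (hd : 0 < d) (hfar : ∀ x ∈ tsupport U, d ≤ ‖x₀ - x‖) :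
    ‖gradient (pot ν U) x₀‖ ≤ 3 / (2 * π * d ^ 4) * ∫ x, ‖U x‖ ^ 2 := by
  set g := gradient (pot ν U) x₀ with hg
  have h := abs_inner_gradient_pot_le_of_far (ν := ν) hU hUc hdiv hd hfar g
  rw [real_inner_self_eq_norm_sq, abs_of_nonneg (sq_nonneg _)] at h
  have hI : 0 ≤ ∫ x, ‖U x‖ ^ 2 := integral_nonneg fun x => by positivity
  have hC : 0 ≤ 3 / (2 * π * d ^ 4) * ∫ x, ‖U x‖ ^ 2 := by positivity
  by_cases hg0 : g = 0
  · rw [hg0, norm_zero]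
    exact hC
  · have hgpos : 0 < ‖g‖ := norm_pos_iff.2 hg0
    have h' : ‖g‖ * ‖g‖ ≤ 3 / (2 * π * d ^ 4) * (∫ x, ‖U x‖ ^ 2) * ‖g‖ := by nlinarith [h]
    exact le_of_mul_le_mul_right h' hgpos

end Summit.NavierStokesRegularity.FluidComputer.PalasekTowerClayBridge.Germ

end
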